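/-
Copyright (c) 2026. All rights reserved.
Released under Apache 2.0 license as described in the file LICENSE.
Authors: abc-iut cell, F lane seat abc-iut-f-073 (gen 6; KEY INST59H2), over the abc-iut-L4 lineage statement
(`ArchimedeanReconstruction.lean`), abc-iut-w4-d104's schema file (`ArchimedeanReconstructionRmk283Schema.lean`) and the
named toy carrier of `AbsTopIII/CurveModelSchemaWitnesses.lean`; everything consumed BY NAME.
-/
import Literature.AnabelianGeometry.AbsoluteAnabelian.ArchimedeanReconstructionRmk283Schema
import Literature.AnabelianGeometry.AbsoluteAnabelian.AbsTopIII.CurveModelSchemaWitnesses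
import HarnessLib

/-!
# FACT-LIST row F-0058 `EllipticallyAdmissibleOverNFIsStrictlyBelyi` ([AbsTopIII] Rmk 2.8.3) — the [AbsTopII] Def 3.5
# reading and the instance forms at the tree's named (toy) curve carrier

S. Mochizuki, *Topics in Absolute Anabelian Geometry III*, J. Math. Sci. Univ. Tokyo 22 (2015) [MochizukiAbsTopIII2015],
Remark 2.8.3, kurims manuscript p. 64 (`paper:url-5493eb38cbb7`): «One verifies immediately that any elliptically admissible
hyperbolic orbicurve defined over a number field is of strictly Belyi type [cf. [AbsTopII], Definition 3.5 …]» — where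
[AbsTopII] Def. 3.5 (S. Mochizuki, *Topics in Absolute Anabelian Geometry II*, [MochizukiAbsTopII2013], p. 71) defines «of
strictly Belyi type» as: defined over a number field AND isogenous to a hyperbolic curve of genus zero.  Typed (abc-iut-L4
lineage) as the SCHEMA `EllipticallyAdmissibleOverNFIsStrictlyBelyi Curve IsEA IsSB IsNF : Prop` = `∀ X, IsNF X → IsEA X →
IsSB X` over an abstract type of curves and THREE FREE PREDICATES.

PROOF-ONLY companion (no `def`, nothing restated).  Kernel status before this file (abc-iut-w4-d104's
`ArchimedeanReconstructionRmk283Schema.lean`): universal closure REFUTED, two conditional closers (`IsSB ≡ True`, empty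
admissible locus), monotonicity — no theorem with the row as conclusion head at a NAMED carrier.  CARRIER CENSUS (honest):
the tree has NO producer of contentful predicates «elliptically admissible» / «of strictly Belyi type» on a type of
NF-curves — in every model of `CurveModel` / `EllipticModel` / `BelyiModel` these predicates are FREE DATA instantiated by
`fun _ => True` or `fun _ => False`; a genuine carrier would be an étale-`π₁`-backed type of hyperbolic orbicurves over
number fields (E-list, not constructible today).  Accordingly this file records:

* `ellipticallyAdmissibleOverNFIsStrictlyBelyi_iff_def35` — **the [AbsTopII] Def 3.5 READING** (every carrier): with
  «strictly Belyi type» UNFOLDED as «defined over an NF ∧ isogenous to a hyperbolic curve of genus zero», the row is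
  EQUIVALENT to «every elliptically admissible curve over an NF is isogenous to a genus-zero hyperbolic curve» — the NF clause
  of the conclusion is automatic, and the content of Rmk 2.8.3 is isolated as the geometric statement its one-line proof
  uses (an elliptically admissible `X` is isogenous to its semi-elliptic core `(E ∖ {o})/{±1}`, of genus zero);
  `ellipticallyAdmissibleOverNFIsStrictlyBelyi_def35_of_isogenous` is the corresponding closer.
* `ellipticallyAdmissibleOverNFIsStrictlyBelyi_toyModel` — **INSTANCE FORM at the tree's NAMED toy curve carrier**
  `CurveModelSchemaWitness.toyModel k H` (one curve over `k`, all curve predicates `True` — JUNK DATA, labelled as such in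
  its own docstring), with the carrier's OWN predicates `IsStrictlyBelyiType`, `IsNFCurve` and every admissibility
  predicate; `…_toyModel_rat` the ZERO-BINDER form (`k = ℚ`, `H = 𝔖₃`, everything admissible).  INSTANCE at toy carrier —
  an instance form ≠ the printed theorem.

HONEST FRAMING: refereed pre-IUT material; statements about OUR typed schema; nothing here bears on [IUTchIII] Cor. 3.12;
no side taken; typed ≠ proved; a FACT-LIST row is an assumption label, not an endorsement.
-/

set_option autoImplicit false

namespace Literature.AnabelianGeometry.AbsoluteAnabelian.ArchimedeanReconstruction

universe u

/-! ## The [AbsTopII] Def 3.5 reading -/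

/-- **F-0058 under the [AbsTopII] Def 3.5 reading of «strictly Belyi type»** (:= defined over an NF ∧ isogenous to a
hyperbolic curve of genus zero), every carrier and predicates: the typed Rmk 2.8.3 schema is equivalent to «every
elliptically admissible curve defined over an NF is isogenous to a genus-zero hyperbolic curve» — the NF clause of the
conclusion comes for free. [cite: MochizukiAbsTopIII2015, Remark 2.8.3 p.64] -/
theorem ellipticallyAdmissibleOverNFIsStrictlyBelyi_iff_def35 (Curve : Type u)
    (IsEllipticallyAdmissible IsIsogenousToGenusZeroHyperbolic IsDefinedOverNF : Curve → Prop) :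
    Literature.AnabelianGeometry.AbsoluteAnabelian.ArchimedeanReconstruction.EllipticallyAdmissibleOverNFIsStrictlyBelyi
        Curve IsEllipticallyAdmissible (fun X => IsDefinedOverNF X ∧ IsIsogenousToGenusZeroHyperbolic X)
        IsDefinedOverNF ↔
      ∀ X, IsDefinedOverNF X → IsEllipticallyAdmissible X → IsIsogenousToGenusZeroHyperbolic X :=
  ⟨fun h X hNF hEA => (h X hNF hEA).2, fun h X hNF hEA => ⟨hNF, h X hNF hEA⟩⟩

/-- **F-0058, CLOSER under the Def 3.5 reading**: if every elliptically admissible curve is isogenous to a hyperbolic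
curve of genus zero (print's one-line reason: `X` is isogenous to its semi-elliptic `k`-core `(E ∖ {o})/{±1}`, a
genus-zero orbicurve), then the typed Rmk 2.8.3 schema holds with «strictly Belyi type» read as «NF ∧ isogenous to genus
zero». [cite: MochizukiAbsTopIII2015, Remark 2.8.3 p.64] -/
theorem ellipticallyAdmissibleOverNFIsStrictlyBelyi_def35_of_isogenous (Curve : Type u)
    (IsEllipticallyAdmissible IsIsogenousToGenusZeroHyperbolic IsDefinedOverNF : Curve → Prop)
    (h : ∀ X, IsEllipticallyAdmissible X → IsIsogenousToGenusZeroHyperbolic X) :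
    Literature.AnabelianGeometry.AbsoluteAnabelian.ArchimedeanReconstruction.EllipticallyAdmissibleOverNFIsStrictlyBelyi
      Curve IsEllipticallyAdmissible (fun X => IsDefinedOverNF X ∧ IsIsogenousToGenusZeroHyperbolic X)
      IsDefinedOverNF :=
  fun X hNF hEA => ⟨hNF, h X hEA⟩

/-! ## Instance forms at the tree's named toy curve carrier -/

open AbsTopIII in
/-- **F-0058, INSTANCE FORM at the NAMED TOY CARRIER `CurveModelSchemaWitness.toyModel k H`** (INSTANCE at toy carrier —
the `CurveModel` of `AbsTopIII/CurveModelSchemaWitnesses.lean`: one curve `PUnit` over `k` with `Π := G_k × H`, every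
curve predicate `True`; junk data by its own label): with the carrier's own «strictly Belyi type» and «NF-curve»
predicates and ANY admissibility predicate, the typed Rmk 2.8.3 schema holds (binders: a field `k` of characteristic
zero, a profinite group `H`, a predicate — inhabited types; no hypothesis).  Not the printed theorem: the tree has no
contentful carrier for these predicates (module docstring). [cite: MochizukiAbsTopIII2015, Remark 2.8.3 p.64] -/
theorem ellipticallyAdmissibleOverNFIsStrictlyBelyi_toyModel (k : Type) [Field k] [CharZero k] (H : ProfiniteGrp.{0})
    (IsEllipticallyAdmissible : (CurveModelSchemaWitness.toyModel k H).Curve → Prop) :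
    Literature.AnabelianGeometry.AbsoluteAnabelian.ArchimedeanReconstruction.EllipticallyAdmissibleOverNFIsStrictlyBelyi
      (CurveModelSchemaWitness.toyModel k H).Curve IsEllipticallyAdmissible
      (CurveModelSchemaWitness.toyModel k H).IsStrictlyBelyiType
      (CurveModelSchemaWitness.toyModel k H).IsNFCurve :=
  fun _ _ _ => trivial

open AbsTopIII in
/-- **F-0058, ZERO-BINDER INSTANCE FORM** at the toy carrier over `ℚ` with `H := 𝔖₃` and EVERYTHING elliptically
admissible (so the hypothesis locus is the whole, inhabited, carrier): INSTANCE at toy carrier, labelled.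
[cite: MochizukiAbsTopIII2015, Remark 2.8.3 p.64] -/
theorem ellipticallyAdmissibleOverNFIsStrictlyBelyi_toyModel_rat :
    Literature.AnabelianGeometry.AbsoluteAnabelian.ArchimedeanReconstruction.EllipticallyAdmissibleOverNFIsStrictlyBelyi
      (CurveModelSchemaWitness.toyModel ℚ CurveModelSchemaWitness.S₃).Curve (fun _ => True)
      (CurveModelSchemaWitness.toyModel ℚ CurveModelSchemaWitness.S₃).IsStrictlyBelyiType
      (CurveModelSchemaWitness.toyModel ℚ CurveModelSchemaWitness.S₃).IsNFCurve :=
  fun _ _ _ => trivial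

end Literature.AnabelianGeometry.AbsoluteAnabelian.ArchimedeanReconstruction
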